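import Literature.NumberTheory.EllipticCurves.Rank1Residual.Typed.KolyvaginCertificate
import Summits.BirchSwinnertonDyer.Rank1Residual.X11b.ChaPairsMinimality
import Summits.BirchSwinnertonDyer.Rank1Residual.X11b.CertificateCheckBridge
import Summits.BirchSwinnertonDyer.BirchSwinnertonDyer.Theorems.Rank1ResidualIntModelSurjectivity
import Summits.BirchSwinnertonDyer.BirchSwinnertonDyer.Theorems.Rank1ResidualX11RankOneMinimality
import Summits.BirchSwinnertonDyer.BirchSwinnertonDyer.Theorems.Rank1ResidualIntModelReduction
import HarnessLib

/-!
# BSD rank-≤1 residual cell, class X4 at `p = 5`, rank one: the KIT of the Kolyvagin HEEGNER-INDEX records —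
# `BSD(E,5)` for a literal integer model from kernel-decidable model checks, three Serre witness COUNTS,
# the published named facts and the per-pair Heegner-index certificate

HONEST FRAMING (cell `b2b-bsdres-*`, verbatim): prove what is provable now; shrink each hard class to its core with
data; no claim beyond stated classes; COMBINATION classes deleted from PUBLISHED theorems only, CONSTRUCTION-shaped
remainder typed; this is not "finishing BSD". Class X4 stays CONSTRUCTION-SHAPED; PER PAIR; nothing booked; no named
fact introduced; no definition. Unit `b2b-bsdres-x11c`, GEN 26 (prover-b2b-bsdres-x11c-g26-0).

WHAT THIS FILE IS: ONE THEOREM that packages, once, the kernel side of the unit's per-pair Kolyvagin-index records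
(`X4/KolyvaginIndexRecordsRankOneNN.lean`), so that each record is one short theorem whose numeric hypotheses are
`decide` goals — `bsdp_five_of_kolyvaginIndex_of_serreCounts`: for `W = [a₁,…,a₆]` (integers): `Δ ≠ 0` and the bounded Kraus
  criterion (`X11RankOne.isGloballyMinimal_of_krausCriterion_bounded`) give `IsElliptic` / `IsGloballyMinimal`; three
  witness primes `ℓᵢ ∉ {2, 5}`, `ℓᵢ ∤ Δ`, with the schema's kernel-evaluable `countPoints [a₁,…,a₆] ℓᵢ = nᵢ`
  (`X11RankOneCertificates/Schema.lean`; CORRECT by `X11b/CertificateCheckBridge.natCard_point_eq_countPoints`) and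
  Serre's three conditions mod `5` on `aᵢ = ℓᵢ + 1 − nᵢ` give `ρ̄_{E,5}` ONTO (Serre 1972 Prop. 19, the tree's
  `IntModel.hasSurjectiveModNGaloisRep_of_intModel_of_serreWitnesses`); then the tree's class-agnostic consumer
  `Typed.bsdp_of_kolyvagin_of_not_dvd_index` (Kolyvagin as printed by McCallum 1991 §1 / Gross 1991 Prop. 2.1 (2):
  named facts `kolyvagin`, `Kolyvagin1990_padicValNat_card_sha_le`; Gross–Zagier–Kolyvagin `hGZK`) turns the Heegner
  datum (`K` imaginary quadratic with the Heegner hypothesis for the level `N`, `P = y_K` of infinite order,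
  `5 ∤ [E(K):ℤP]`), `r_an ≤ 1` and `#Ш_an = q` with `ord₅ q = 0` into Miller's `BSD(E,5)`.
Every numeric hypothesis is a `decide` goal for a literal record; every other hypothesis is a displayed binder of the
record theorem. Nothing about any particular curve is asserted here.

References: Serre 1972 §2.8 Prop. 19 [Serre1972]; McCallum 1991 §1 [McCallumLMS1991]; Gross 1991 Prop. 2.1
[GrossLMS1991]; Miller 2011 Def. 1.1 [Miller2011LMS]; Silverman AEC VII.1 Remark 1.1, VIII.8 [SilvermanAEC2009];
Ireland–Rosen Prop. 5.1.2 [IrelandRosen1990].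
-/

set_option autoImplicit false

noncomputable section

open scoped Classical

open WeierstrassCurve Literature.NumberTheory.EllipticCurves
  Literature.NumberTheory.EllipticCurves.Rank1Residual
  Literature.NumberTheory.EllipticCurves.Rank1Residual.Typed
  Literature.NumberTheory.EllipticCurves.Rank1Residual.X11RankOneCertificates
  Summit.BirchSwinnertonDyer.BirchSwinnertonDyer.Rank1Residual.IntModel
  Summit.BirchSwinnertonDyer.BirchSwinnertonDyer.Rank1Residual.X11RankOne

namespace Summit.BirchSwinnertonDyer.Rank1Residual.X4

/-- **`BSD(E,5)` for a literal integer model from the Kolyvagin HEEGNER-INDEX certificate.** Inputs: (kernel, `decide`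
goals for a record) `Δ ≠ 0`, `|Δ| < 512¹²` and the bounded Kraus disjunction below `512` (⇒ `IsElliptic`,
`IsGloballyMinimal`); three primes `ℓ₁, ℓ₂, ℓ₃ ∉ {2,5}` not dividing `Δ` with `countPoints = nᵢ` and, for
`aᵢ = ℓᵢ + 1 − nᵢ` mod `5`: (s₁) `a₁² − 4ℓ₁` a non-zero square and `a₁ ≠ 0`, (s₂) `a₂² − 4ℓ₂` a non-square and `a₂ ≠ 0`,
(s₃) `a₃² = uℓ₃` with `u ∉ {0,1,2,4}`, `u² − 3u + 1 ≠ 0` (⇒ `ρ̄_{E,5}` onto, Serre Prop. 19); (binders) GZK `hGZK`,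
Kolyvagin as printed (`hKo`, `hB`), the Heegner datum `K`, `N`, `P` with `5 ∤ [E(K):ℤP]`, `r_an ≤ 1`, `#Ш_an = q` with
`ord₅ q = 0`. Output: Miller's `BSD(E,5)` (`Typed.bsdp_of_kolyvagin_of_not_dvd_index`). Per pair; no class statement.
[cite: Serre1972, §2.8 Prop. 19] [cite: McCallumLMS1991, §1 Theorem (Kolyvagin), p. 296]
[cite: GrossLMS1991, §2 Prop. 2.1 (2)] [cite: Miller2011LMS, §1 and Def. 1.1] [cite: SilvermanAEC2009, VII.1 Remark 1.1] -/
theorem bsdp_five_of_kolyvaginIndex_of_serreCounts (a1 a2 a3 a4 a6 : ℤ)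
    (h0 : discOf [a1, a2, a3, a4, a6] ≠ 0) (h512 : (discOf [a1, a2, a3, a4, a6]).natAbs < 512 ^ 12)
    (hKraus : ∀ q < 512, q < 2 ∨ ¬ q ^ 12 ∣ (discOf [a1, a2, a3, a4, a6]).natAbs ∨
      ¬ q ^ 4 ∣ (c4Of [a1, a2, a3, a4, a6]).natAbs ∨
      (q = 2 ∧ ¬ (2 : ℤ) ^ 8 ∣ c4Of [a1, a2, a3, a4, a6] ∧ (2 : ℤ) ^ 7 ∣ c6Of [a1, a2, a3, a4, a6]) ∨
      (q = 2 ∧ ¬ (2 : ℤ) ^ 24 ∣ discOf [a1, a2, a3, a4, a6] ∧ (512 : ℤ) ∣ c6Of [a1, a2, a3, a4, a6] ∧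
        (4 : ℤ) ∣ c6Of [a1, a2, a3, a4, a6] / 512 - 3) ∨
      (q = 3 ∧ (3 : ℤ) ^ 8 ∣ c6Of [a1, a2, a3, a4, a6] ∧ ¬ (3 : ℤ) ^ 9 ∣ c6Of [a1, a2, a3, a4, a6]))
    (ℓ₁ ℓ₂ ℓ₃ : ℕ) (hp₁ : ℓ₁.Prime) (hp₂ : ℓ₂.Prime) (hp₃ : ℓ₃.Prime)
    (h2₁ : ℓ₁ ≠ 2) (h2₂ : ℓ₂ ≠ 2) (h2₃ : ℓ₃ ≠ 2) (h5₁ : ℓ₁ ≠ 5) (h5₂ : ℓ₂ ≠ 5) (h5₃ : ℓ₃ ≠ 5)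
    (hΔ₁ : ¬ (ℓ₁ : ℤ) ∣ (⟨a1, a2, a3, a4, a6⟩ : WeierstrassCurve ℤ).Δ)
    (hΔ₂ : ¬ (ℓ₂ : ℤ) ∣ (⟨a1, a2, a3, a4, a6⟩ : WeierstrassCurve ℤ).Δ)
    (hΔ₃ : ¬ (ℓ₃ : ℤ) ∣ (⟨a1, a2, a3, a4, a6⟩ : WeierstrassCurve ℤ).Δ)
    {n₁ n₂ n₃ : ℕ} (hc₁ : countPoints [a1, a2, a3, a4, a6] ℓ₁ = n₁)
    (hc₂ : countPoints [a1, a2, a3, a4, a6] ℓ₂ = n₂) (hc₃ : countPoints [a1, a2, a3, a4, a6] ℓ₃ = n₃)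
    (hi : IsSquare ((((ℓ₁ : ℤ) + 1 - n₁ : ℤ) : ZMod 5) ^ 2 - 4 * ℓ₁) ∧
      (((ℓ₁ : ℤ) + 1 - n₁ : ℤ) : ZMod 5) ^ 2 - 4 * ℓ₁ ≠ 0 ∧ (((ℓ₁ : ℤ) + 1 - n₁ : ℤ) : ZMod 5) ≠ 0)
    (hii : ¬ IsSquare ((((ℓ₂ : ℤ) + 1 - n₂ : ℤ) : ZMod 5) ^ 2 - 4 * ℓ₂) ∧
      (((ℓ₂ : ℤ) + 1 - n₂ : ℤ) : ZMod 5) ≠ 0)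
    (hiii : ∃ u : ZMod 5, (((ℓ₃ : ℤ) + 1 - n₃ : ℤ) : ZMod 5) ^ 2 = u * ℓ₃ ∧
      u ≠ 0 ∧ u ≠ 1 ∧ u ≠ 2 ∧ u ≠ 4 ∧ u ^ 2 - 3 * u + 1 ≠ 0)
    (hGZK : rank_eq_analyticRank_of_analyticRank_le_one)
    (W : WeierstrassCurve ℚ) (hW : W = ⟨a1, a2, a3, a4, a6⟩)
    {N : ℕ} [NeZero N] {K : Type} [Field K] [NumberField K] (hKo : kolyvagin N W K)
    (hB : Kolyvagin1990_padicValNat_card_sha_le N W K) (hK : IsImaginaryQuadratic K)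
    (hH : SatisfiesHeegnerHypothesis N K) {P : (W.baseChange K).toAffine.Point}
    (hP : IsHeegnerPoint N W K P) (hnt : ¬ IsOfFinAddOrder P)
    (hI : ¬ 5 ∣ (AddSubgroup.zmultiples P).index)
    (hr : W.analyticRank ≤ 1) {q : ℚ} (hq : shaAn W = (q : ℂ)) (hv : padicValRat 5 q = 0) :
    BSDp W 5 := by
  subst hW
  haveI hE : (⟨a1, a2, a3, a4, a6⟩ : WeierstrassCurve ℚ).IsElliptic :=
    X11b.isElliptic_of_discOf_ne_zero a1 a2 a3 a4 a6 h0
  haveI hM : (⟨a1, a2, a3, a4, a6⟩ : WeierstrassCurve ℚ).IsGloballyMinimal :=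
    isGloballyMinimal_of_krausCriterion_bounded a1 a2 a3 a4 a6 h0 h512 hKraus
  haveI : Fact (Nat.Prime 5) := ⟨by norm_num⟩
  haveI := Fact.mk hp₁; haveI := Fact.mk hp₂; haveI := Fact.mk hp₃
  have hI0 : integralModelInt (⟨a1, a2, a3, a4, a6⟩ : WeierstrassCurve ℚ) = ⟨a1, a2, a3, a4, a6⟩ :=
    integralModelInt_eq_of_map_eq _ (map_mk_int a1 a2 a3 a4 a6)
  -- the three witness counts in `Nat.card` form (the schema's `countPoints` is CORRECT:
  -- `X11b.natCard_point_eq_countPoints`; the same two-line step as the cell's O5 Heegner-index rows)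
  have hn₁ : Nat.card (((⟨a1, a2, a3, a4, a6⟩ : WeierstrassCurve ℤ).map
      (Int.castRingHom (ZMod ℓ₁))).toAffine.Point) = n₁ := by
    exact_mod_cast (X11b.natCard_point_eq_countPoints a1 a2 a3 a4 a6 ℓ₁ h2₁ hΔ₁).trans hc₁
  have hn₂ : Nat.card (((⟨a1, a2, a3, a4, a6⟩ : WeierstrassCurve ℤ).map
      (Int.castRingHom (ZMod ℓ₂))).toAffine.Point) = n₂ := by
    exact_mod_cast (X11b.natCard_point_eq_countPoints a1 a2 a3 a4 a6 ℓ₂ h2₂ hΔ₂).trans hc₂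
  have hn₃ : Nat.card (((⟨a1, a2, a3, a4, a6⟩ : WeierstrassCurve ℤ).map
      (Int.castRingHom (ZMod ℓ₃))).toAffine.Point) = n₃ := by
    exact_mod_cast (X11b.natCard_point_eq_countPoints a1 a2 a3 a4 a6 ℓ₃ h2₃ hΔ₃).trans hc₃
  have hρ : (⟨a1, a2, a3, a4, a6⟩ : WeierstrassCurve ℚ).HasSurjectiveModNGaloisRep 5 :=
    hasSurjectiveModNGaloisRep_of_intModel_of_serreWitnesses hI0 5 (by norm_num) ℓ₁ ℓ₂ ℓ₃ h5₁ h5₂ h5₃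
      hΔ₁ hΔ₂ hΔ₃ hn₁ hn₂ hn₃ hi hii hiii
  exact bsdp_of_kolyvagin_of_not_dvd_index _ 5 hGZK hKo hB hK hH hP hnt (by norm_num) hρ hI hr hq hv

end Summit.BirchSwinnertonDyer.Rank1Residual.X4

end
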